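import Mathlib.Analysis.InnerProductSpace.GramSchmidtOrtho
import Mathlib.Analysis.InnerProductSpace.Calculus
import Mathlib.Analysis.SpecialFunctions.Sqrt
import HarnessLib

/-!
# Smooth dependence of the Gram–Schmidt process on parameters

Topic `Literature/Analysis/InnerProduct`.  If a family of vectors `f x i` of a real inner
product space depends in a `C^n` way on a parameter `x` ranging over a set `u` of a normed
space, and is linearly independent for every `x ∈ u`, then the Gram–Schmidt orthogonalised
vectors `gramSchmidt ℝ (f x) i` and their normalisations `gramSchmidtNormed ℝ (f x) i` are `C^n`
in `x` on `u` (`ContDiffOn.gramSchmidt_family`, `ContDiffOn.gramSchmidtNormed_family`): the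
Gram–Schmidt recursion
`gramSchmidt f i = f i - ∑_{j<i} (⟪gs f j, f i⟫ / ‖gs f j‖²) • gs f j` (Mathlib's
`gramSchmidt_def''`) only involves inner products and divisions by the non-vanishing
`‖gs f j‖²` (well-founded induction on `i`).  This is the elementary remark behind smooth
orthonormal frames — Warner, *Foundations of Differentiable Manifolds and Lie Groups*, GTM 94
(1983), 4.10, p. 149: *"apply the usual Gram–Schmidt procedure to orthonormalize the vector
fields … and do it simultaneously at all points of `U`"* — and behind the `O(k)`-reduction of
a smooth family of invertible matrices in the uniqueness of tubular neighbourhoods (Kosinski,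
*Differential Manifolds* (1993), II (4.6) with III (3.1), (3.5)).  The tree has the same
statement for sections of a Riemannian vector bundle
(`Literature/Geometry/Kaehler/GramSchmidtBundle.lean`); this file is the plain-calculus form
(`ContDiffOn` in a normed space), which that file does not provide.

Also recorded: the two order-theoretic facts about Gram–Schmidt used to show that a matrix with
linearly independent columns is joined to its orthonormalisation by a segment of invertible
matrices — `inner_gramSchmidtNormed_self_pos` (`⟪q_i, f i⟫ > 0`) and
`gramSchmidtNormed_inner_eq_zero_of_lt` (`⟪q_j, f i⟫ = 0` for `i < j`, Mathlib's
`gramSchmidt_inv_triangular` normalised).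

Everything here is proved; no named facts are introduced.

## References

* F. W. Warner, *Foundations of Differentiable Manifolds and Lie Groups*, GTM 94 (1983), 4.10,
  p. 149. [WarnerGTM94]
* A. A. Kosinski, *Differential Manifolds*, Academic Press (1993), II (4.6); III (3.1), (3.5).
  [Kosinski1993]
-/

noncomputable section

open Set Function Finset InnerProductSpace

open scoped ContDiff InnerProductSpace

namespace Literature.Analysis.InnerProduct

variable {X : Type*} [NormedAddCommGroup X] [NormedSpace ℝ X]
  {E : Type*} [NormedAddCommGroup E] [InnerProductSpace ℝ E]
  {ι : Type*} [LinearOrder ι] [LocallyFiniteOrderBot ι] [WellFoundedLT ι]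
  {n : WithTop ℕ∞}

/-- **Smooth dependence of Gram–Schmidt on parameters.**  If `x ↦ f x i` is `C^n` on `u` for
every `i` and the family `f x` is linearly independent for every `x ∈ u`, then
`x ↦ gramSchmidt ℝ (f x) i` is `C^n` on `u`.  Well-founded induction along `gramSchmidt_def''`.
[cite: WarnerGTM94, 4.10, p. 149] -/
theorem _root_.ContDiffOn.gramSchmidt_family {f : X → ι → E} {u : Set X}
    (hf : ∀ i, ContDiffOn ℝ n (fun x => f x i) u) (hli : ∀ x ∈ u, LinearIndependent ℝ (f x))
    (i : ι) : ContDiffOn ℝ n (fun x => gramSchmidt ℝ (f x) i) u := by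
  induction i using WellFoundedLT.induction with | ind i ih =>
  -- the coefficient of `gramSchmidt _ j` in the recursion
  set c : ι → X → ℝ := fun j x =>
    ⟪gramSchmidt ℝ (f x) j, f x i⟫_ℝ / ‖gramSchmidt ℝ (f x) j‖ ^ 2 with hc
  have heq : (fun x => gramSchmidt ℝ (f x) i) =
      fun x => f x i - ∑ j ∈ Finset.Iio i, c j x • gramSchmidt ℝ (f x) j := by
    funext x
    rw [eq_sub_of_add_eq (gramSchmidt_def'' ℝ (f x) i).symm]
    simp only [hc, RCLike.ofReal_real_eq_id, id_eq]
  rw [heq]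
  intro x hx
  refine (hf i x hx).sub (ContDiffWithinAt.sum fun j hj => ?_)
  have hj' : j < i := Finset.mem_Iio.1 hj
  have hgs : ContDiffWithinAt ℝ n (fun x => gramSchmidt ℝ (f x) j) u x := ih j hj' x hx
  refine ContDiffWithinAt.smul ?_ hgs
  have hnum : ContDiffWithinAt ℝ n (fun x => ⟪gramSchmidt ℝ (f x) j, f x i⟫_ℝ) u x :=
    hgs.inner ℝ (hf i x hx)
  have hden : ContDiffWithinAt ℝ n (fun x => ‖gramSchmidt ℝ (f x) j‖ ^ 2) u x := by
    have := hgs.inner ℝ hgs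
    simp_rw [real_inner_self_eq_norm_sq] at this
    exact this
  have hne : ‖gramSchmidt ℝ (f x) j‖ ^ 2 ≠ 0 :=
    pow_ne_zero _ (norm_ne_zero_iff.2 (gramSchmidt_ne_zero j (hli x hx)))
  exact hnum.div hden hne

/-- **The normalised Gram–Schmidt vectors depend smoothly on parameters** (normalising factor
`‖gs f i‖⁻¹ = (√⟪gs f i, gs f i⟫)⁻¹`, smooth since `gs f i ≠ 0`). [cite: WarnerGTM94, 4.10, p. 149] -/
theorem _root_.ContDiffOn.gramSchmidtNormed_family {f : X → ι → E} {u : Set X}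
    (hf : ∀ i, ContDiffOn ℝ n (fun x => f x i) u) (hli : ∀ x ∈ u, LinearIndependent ℝ (f x))
    (i : ι) : ContDiffOn ℝ n (fun x => gramSchmidtNormed ℝ (f x) i) u := by
  intro x hx
  have hgs := ContDiffOn.gramSchmidt_family hf hli i x hx
  unfold gramSchmidtNormed
  refine ContDiffWithinAt.smul ?_ hgs
  have hsq : ContDiffWithinAt ℝ n (fun x => ‖gramSchmidt ℝ (f x) i‖ ^ 2) u x := by
    have := hgs.inner ℝ hgs
    simp_rw [real_inner_self_eq_norm_sq] at this
    exact this
  have hne : gramSchmidt ℝ (f x) i ≠ 0 := gramSchmidt_ne_zero i (hli x hx)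
  have hnorm : ContDiffWithinAt ℝ n (fun x => ‖gramSchmidt ℝ (f x) i‖) u x := by
    have h2 : (fun x => ‖gramSchmidt ℝ (f x) i‖) =
        Real.sqrt ∘ fun x => ‖gramSchmidt ℝ (f x) i‖ ^ 2 := by
      funext x
      simp [Real.sqrt_sq (norm_nonneg _)]
    rw [h2]
    refine ContDiffAt.comp_contDiffWithinAt x ?_ hsq
    exact Real.contDiffAt_sqrt (pow_ne_zero _ (norm_ne_zero_iff.2 hne))
  exact hnorm.inv (norm_ne_zero_iff.2 hne)

/-- Pointwise (`ContDiffAt`) form on an open set of parameters. [cite: WarnerGTM94, 4.10, p. 149] -/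
theorem _root_.ContDiffAt.gramSchmidtNormed_family {f : X → ι → E} {u : Set X} (hu : IsOpen u)
    (hf : ∀ i, ContDiffOn ℝ n (fun x => f x i) u) (hli : ∀ x ∈ u, LinearIndependent ℝ (f x))
    (i : ι) {x : X} (hx : x ∈ u) : ContDiffAt ℝ n (fun x => gramSchmidtNormed ℝ (f x) i) x :=
  (ContDiffOn.gramSchmidtNormed_family hf hli i).contDiffAt (hu.mem_nhds hx)

/-! ### The triangular structure of Gram–Schmidt, with signs -/

omit [NormedAddCommGroup X] [NormedSpace ℝ X] in
/-- **`⟪q_i, f i⟫ > 0`**: the `i`-th Gram–Schmidt unit vector makes an acute angle with the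
`i`-th input vector, since `f i = gs f i + (combination of gs f j, j < i)` and the `gs f j` are
orthogonal to `gs f i`. [folklore] -/
theorem inner_gramSchmidtNormed_self_pos {f : ι → E} (hf : LinearIndependent ℝ f) (i : ι) :
    0 < ⟪gramSchmidtNormed ℝ f i, f i⟫_ℝ := by
  have hne : gramSchmidt ℝ f i ≠ 0 := gramSchmidt_ne_zero i hf
  -- `⟪gs f i, f i⟫ = ‖gs f i‖²`
  have hkey : ⟪gramSchmidt ℝ f i, f i⟫_ℝ = ‖gramSchmidt ℝ f i‖ ^ 2 := by
    conv_lhs => rw [gramSchmidt_def'' ℝ f i]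
    rw [inner_add_right, real_inner_self_eq_norm_sq, inner_sum]
    have hzero : ∀ j ∈ Finset.Iio i,
        ⟪gramSchmidt ℝ f i, (⟪gramSchmidt ℝ f j, f i⟫_ℝ / (‖gramSchmidt ℝ f j‖ : ℝ) ^ 2) •
          gramSchmidt ℝ f j⟫_ℝ = 0 := by
      intro j hj
      rw [real_inner_smul_right, gramSchmidt_orthogonal ℝ f (Finset.mem_Iio.1 hj).ne', mul_zero]
    simp only [RCLike.ofReal_real_eq_id, id_eq] at hzero ⊢
    rw [Finset.sum_eq_zero hzero, add_zero]
  have hpos : 0 < ⟪gramSchmidt ℝ f i, f i⟫_ℝ := by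
    rw [hkey]
    exact pow_pos (norm_pos_iff.2 hne) 2
  rw [gramSchmidtNormed, real_inner_smul_left]
  exact mul_pos (inv_pos.2 (norm_pos_iff.2 hne)) hpos

omit [NormedAddCommGroup X] [NormedSpace ℝ X] in
/-- **`⟪q_j, f i⟫ = 0` for `i < j`** (Mathlib's `gramSchmidt_inv_triangular`, normalised).
[folklore] -/
theorem gramSchmidtNormed_inner_eq_zero_of_lt (f : ι → E) {i j : ι} (hij : i < j) :
    ⟪gramSchmidtNormed ℝ f j, f i⟫_ℝ = 0 := by
  rw [gramSchmidtNormed, real_inner_smul_left, gramSchmidt_inv_triangular ℝ f hij, mul_zero]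

/-- **The segment from a linearly independent family to its orthonormalisation consists of
linearly independent families, coordinate form.**  Let `f` be linearly independent with
Gram–Schmidt unit vectors `q`, and let `w : ι → ℝ` be finitely supported coefficients with
`(1 - t) w i + t ∑_l w l ⟪q_i, f l⟫ = 0` for all `i`, where `t ∈ [0, 1]`.  Then `w = 0`: at the
largest index `i` with `w i ≠ 0` the sum reduces to `w i ⟪q_i, f i⟫` (`⟪q_i, f l⟫ = 0` for
`l < i`), and `(1 - t) + t ⟪q_i, f i⟫ > 0`. [cite: Kosinski1993, II (4.6)] -/
theorem eq_zero_of_segment_gramSchmidtNormed {f : ι → E} (hf : LinearIndependent ℝ f)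
    {t : ℝ} (ht : t ∈ Icc (0 : ℝ) 1) {w : ι → ℝ} (s : Finset ι) (hws : ∀ i, i ∉ s → w i = 0)
    (h : ∀ i ∈ s, (1 - t) * w i + t * ∑ l ∈ s, w l * ⟪gramSchmidtNormed ℝ f i, f l⟫_ℝ = 0) :
    ∀ i, w i = 0 := by
  by_contra hcontra
  push Not at hcontra
  -- the largest index with `w i ≠ 0` (it lies in `s`)
  set s' : Finset ι := s.filter fun i => w i ≠ 0 with hs'
  have hne : s'.Nonempty := by
    obtain ⟨i, hi⟩ := hcontra
    refine ⟨i, Finset.mem_filter.2 ⟨?_, hi⟩⟩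
    by_contra his
    exact hi (hws i his)
  set i := s'.max' hne with hi
  have his' : i ∈ s' := Finset.max'_mem s' hne
  have his : i ∈ s := (Finset.mem_filter.1 his').1
  have hwi : w i ≠ 0 := (Finset.mem_filter.1 his').2
  have hmax : ∀ l ∈ s, i < l → w l = 0 := by
    intro l hl hil
    by_contra hwl
    have hl' : l ∈ s' := Finset.mem_filter.2 ⟨hl, hwl⟩
    exact absurd (Finset.le_max' s' l hl') (not_le.2 (hi ▸ hil))
  -- the sum reduces to the diagonal term
  have hsum : ∑ l ∈ s, w l * ⟪gramSchmidtNormed ℝ f i, f l⟫_ℝ =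
      w i * ⟪gramSchmidtNormed ℝ f i, f i⟫_ℝ := by
    rw [← Finset.sum_erase_add _ _ his]
    have hzero : ∑ l ∈ s.erase i, w l * ⟪gramSchmidtNormed ℝ f i, f l⟫_ℝ = 0 := by
      refine Finset.sum_eq_zero fun l hl => ?_
      obtain ⟨hli, hl⟩ := Finset.mem_erase.1 hl
      rcases lt_or_gt_of_ne hli with h1 | h1
      · rw [gramSchmidtNormed_inner_eq_zero_of_lt f h1, mul_zero]
      · rw [hmax l hl h1, zero_mul]
    rw [hzero, zero_add]
  have hii := h i his
  rw [hsum] at hii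
  have hfac : (1 - t) * w i + t * (w i * ⟪gramSchmidtNormed ℝ f i, f i⟫_ℝ) =
      w i * ((1 - t) + t * ⟪gramSchmidtNormed ℝ f i, f i⟫_ℝ) := by ring
  rw [hfac] at hii
  have hpos : 0 < (1 - t) + t * ⟪gramSchmidtNormed ℝ f i, f i⟫_ℝ := by
    have hd := inner_gramSchmidtNormed_self_pos hf i
    rcases eq_or_lt_of_le ht.2 with h1 | h1
    · rw [h1]; simpa using hd
    · have : 0 ≤ t * ⟪gramSchmidtNormed ℝ f i, f i⟫_ℝ := mul_nonneg ht.1 hd.le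
      linarith
  rcases mul_eq_zero.1 hii with h1 | h1
  · exact hwi h1
  · exact hpos.ne' h1

end Literature.Analysis.InnerProduct

end
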